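import Summits.QuantumFields.QCD.Theorems.SpectralDefectExtinctionWindowExtinctionChessboardDefs
import Summits.QuantumFields.QCD.Theorems.SpectralDefectExtinctionWindowExtinctionChessboardOddCycle
import Summits.QuantumFields.QCD.Theorems.SpectralDefectExtinctionWindowExtinctionChessboardFlatCubeEvent
import Literature.MathematicalPhysics.QuantumFieldTheory.ConstructiveQFTWave0OddRPProofs
import Literature.MathematicalPhysics.QuantumFieldTheory.LatticeGaugeProofs

/-!
# Crux `WindowExtinction` (stmt-QuantumFields-8964), line `chessboard-cold-cells`: stub (S1)
`stub_chessboard` — the time-column chessboard estimate on ODD tori, Peierls form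

On the four-torus `(ℤ/(2S+1)ℤ)⁴`, `S ≥ 1`, `β ≥ 0`: if every time-invariant pattern `X × ℤ_{2S+1}` of
`θ`-flat spatial unit 3-cubes has Wilson probability `≤ q^{(2S+1)|X|}`, then every finite set `A` of
`θ`-flat cubes has probability `≤ q^{|A|}` (Fröhlich–Israel–Lieb–Simon, CMP 62 (1978) Thm 2.2, in
the time direction).

## Proof

We do NOT use a transfer matrix.  The chessboard estimate on a cycle of ODD length `N = 2S+1` follows
from reflection positivity about the `N` reflections `t ↦ 2a + 1 - t` of the cycle (each fixing one
edge midpoint and the antipodal vertex) by the Fröhlich–Israel–Lieb–Simon MAXIMISATION argument: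
for slice-local non-negative observables `f_t` the RP Schwarz inequality reads
`Φ(σ)² ≤ Φ(σ⁺) Φ(σ⁻)`, where `σ⁺` keeps the closed half `1 ≤ t ≤ S+1` and reflects it onto the rest and
`σ⁻` keeps the complementary closed half; a maximiser of `Φ(σ ∘ ρ)^N / ∏_t w(ρ t)` over the finitely
many re-indexings `ρ` stays a maximiser under `ρ ↦ ρ⁺` and under rotations, and the "run-doubling
walk" `ρ ↦ rot_{-ℓ} (ρ⁺)` turns any assignment into a constant one in finitely many such steps; at a
constant assignment the ratio is `1` (support file `…ChessboardOddCycle`, `OddCycle.chessboard`, purely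
combinatorial).

The analytic input (support file `…ChessboardFlatCubeEvent` and §D below) is the tree's
single-reflection Osterwalder–Seiler positivity on the odd
torus `wilsonExpectation_oddReflectionPositive` (reflection `θ t = 1 - t`, observables of the spatial
links of the slices `1 ≤ t ≤ S+1`), turned into the Schwarz inequality for indicator observables by
testing it on `F + iG` (symmetry of the form) and `xF - G` (discriminant), the time-translation
invariance `wilsonMeasure_map_torusConfigShift`, slice-locality and reflection/translation
covariance of the flat-cube event `CubeFlat`, and its measurability (the event is closed: projection
along the compact unit sphere of colour fields of a closed set).
-/

noncomputable section

namespace Summit.QuantumFields.QCD.Cruxes.WindowExtinction.ChessboardColdCells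

open MeasureTheory
open scoped ENNReal BigOperators ComplexConjugate ComplexOrder
open Literature.MathematicalPhysics.QuantumLattice Literature.MathematicalPhysics.QuantumFieldTheory
  Literature.Probability.LatticeModels

/-! ## §D  Slice-pattern events on the odd torus and the reflection Schwarz inequality -/

section Events

open OddCycle

variable {S : ℕ} {θ β : ℝ}

/-- The joint flat event of an assignment of spatial patterns to the time slices. -/
def ev (S : ℕ) (θ : ℝ) (σ : ZMod (2 * S + 1) → Pattern S) : Set (GaugeConfig 4 (2 * S + 1) SU3) :=
  {U | ∀ t, ∀ xs ∈ σ t, CubeFlat U (siteOf t xs) θ}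

/-- Restriction of an assignment to the closed positive half (empty patterns elsewhere). -/
def halfOf (σ : ZMod (2 * S + 1) → Pattern S) : ZMod (2 * S + 1) → Pattern S :=
  fun t => if t ∈ cPlus S then σ t else ∅

/-- Gluing: the assignment whose joint event is `ev (halfOf τ) ∩ Θ⁻¹ ev (halfOf τ')`. -/
def glue (τ τ' : ZMod (2 * S + 1) → Pattern S) : ZMod (2 * S + 1) → Pattern S :=
  fun u => if u ∈ cMinus S then τ u else if u ∈ cPlus S then τ u ∪ τ' u else τ' (1 - u)

/-- The joint flat events are measurable. -/
theorem measurableSet_ev (σ : ZMod (2 * S + 1) → Pattern S) : MeasurableSet (ev S θ σ) := by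
  have : ev S θ σ = ⋂ t, ⋂ xs ∈ σ t, {U | CubeFlat U (siteOf t xs) θ} := by
    ext U
    simp [ev, Set.mem_iInter]
  rw [this]
  exact MeasurableSet.iInter fun t => (σ t).measurableSet_biInter fun xs _ =>
    measurableSet_cubeFlat _ _

/-- The open half reflects into the complement of the closed half. -/
theorem not_cPlus_one_sub (hS : 1 ≤ S) {t : ZMod (2 * S + 1)} (h : t ∈ cMinus S) : (1 - t) ∉ cPlus S := by
  have hv := val_one_sub hS t
  rw [mem_cMinus] at h
  rw [mem_cPlus]
  split_ifs at hv with h1 <;> omega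

/-- The complement of the closed half reflects into the open half. -/
theorem cMinus_one_sub (hS : 1 ≤ S) {t : ZMod (2 * S + 1)} (h : t ∉ cPlus S) : (1 - t) ∈ cMinus S := by
  have hv := val_one_sub hS t
  have ht := ZMod.val_lt t
  rw [mem_cPlus] at h
  rw [mem_cMinus]
  split_ifs at hv with h1 <;> omega

/-- **Gluing lemma**: `ev (halfOf τ) ∩ Θ⁻¹ ev (halfOf τ') = ev (glue τ τ')`. -/
theorem ev_halfOf_inter (hS : 1 ≤ S) (τ τ' : ZMod (2 * S + 1) → Pattern S) :
    ev S θ (halfOf τ) ∩ GaugeConfig.timeReflect ⁻¹' ev S θ (halfOf τ') = ev S θ (glue τ τ') := by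
  ext U
  simp only [Set.mem_inter_iff, Set.mem_preimage, ev, halfOf, glue, Set.mem_setOf_eq,
    cubeFlat_timeReflect, timeReflect_siteOf]
  constructor
  · rintro ⟨h1, h2⟩ u xs hxs
    by_cases hm : u ∈ cMinus S
    · rw [if_pos hm] at hxs
      exact h1 u xs (by rw [if_pos (cPlus_of_cMinus hm)]; exact hxs)
    · rw [if_neg hm] at hxs
      by_cases hp : u ∈ cPlus S
      · rw [if_pos hp, Finset.mem_union] at hxs
        rcases hxs with hxs | hxs
        · exact h1 u xs (by rw [if_pos hp]; exact hxs)
        · have := h2 u xs (by rw [if_pos hp]; exact hxs)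
          rwa [one_sub_eq_self hS hp hm] at this
      · rw [if_neg hp] at hxs
        have := h2 (1 - u) xs (by rw [if_pos (cPlus_of_cMinus (cMinus_one_sub hS hp))]; exact hxs)
        rwa [sub_sub_cancel] at this
  · intro h
    refine ⟨fun t xs hxs => ?_, fun t xs hxs => ?_⟩
    · by_cases hp : t ∈ cPlus S
      · rw [if_pos hp] at hxs
        by_cases hm : t ∈ cMinus S
        · exact h t xs (by rw [if_pos hm]; exact hxs)
        · exact h t xs (by rw [if_neg hm, if_pos hp]; exact Finset.mem_union_left _ hxs)
      · rw [if_neg hp] at hxs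
        exact absurd hxs (Finset.notMem_empty xs)
    · by_cases hp : t ∈ cPlus S
      · rw [if_pos hp] at hxs
        by_cases hm : t ∈ cMinus S
        · have hp' := not_cPlus_one_sub hS hm
          have hm' : (1 - t) ∉ cMinus S := fun h' => hp' (cPlus_of_cMinus h')
          exact h (1 - t) xs (by rw [if_neg hm', if_neg hp', sub_sub_cancel]; exact hxs)
        · rw [one_sub_eq_self hS hp hm]
          exact h t xs (by rw [if_neg hm, if_pos hp]; exact Finset.mem_union_right _ hxs)
      · rw [if_neg hp] at hxs
        exact absurd hxs (Finset.notMem_empty xs)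

/-- `glue σ (minusHalf σ) = σ`. -/
theorem glue_self_minusHalf (hS : 1 ≤ S) (σ : ZMod (2 * S + 1) → Pattern S) :
    glue σ (minusHalf σ) = σ := by
  funext u
  unfold glue minusHalf
  by_cases hm : u ∈ cMinus S
  · rw [if_pos hm]
  · rw [if_neg hm]
    by_cases hp : u ∈ cPlus S
    · rw [if_pos hp, if_neg hm, Finset.union_idempotent]
    · rw [if_neg hp, if_pos (cMinus_one_sub hS hp), sub_sub_cancel]

/-- `glue σ σ = plusHalf σ`. -/
theorem glue_self_self (σ : ZMod (2 * S + 1) → Pattern S) : glue σ σ = plusHalf σ := by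
  funext u
  unfold glue plusHalf
  by_cases hm : u ∈ cMinus S
  · rw [if_pos hm, if_pos (cPlus_of_cMinus hm)]
  · rw [if_neg hm]
    by_cases hp : u ∈ cPlus S
    · rw [if_pos hp, if_pos hp, Finset.union_idempotent]
    · rw [if_neg hp, if_neg hp]

/-- `glue (minusHalf σ) (minusHalf σ) = minusHalf σ`. -/
theorem glue_minusHalf_minusHalf (hS : 1 ≤ S) (σ : ZMod (2 * S + 1) → Pattern S) :
    glue (minusHalf σ) (minusHalf σ) = minusHalf σ := by
  funext u
  unfold glue
  by_cases hm : u ∈ cMinus S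
  · rw [if_pos hm]
  · rw [if_neg hm]
    by_cases hp : u ∈ cPlus S
    · rw [if_pos hp, Finset.union_idempotent]
    · rw [if_neg hp]
      unfold minusHalf
      rw [if_pos (cMinus_one_sub hS hp), if_neg hm, sub_sub_cancel]

/-- The two-term test observable `a·1_{ev(halfOf τ₁)} + b·1_{ev(halfOf τ₂)}`. -/
def obs (θ : ℝ) (a b : ℂ) (τ₁ τ₂ : ZMod (2 * S + 1) → Pattern S) : GaugeConfig 4 (2 * S + 1) SU3 → ℂ :=
  fun U => a * χ (ev S θ (halfOf τ₁)) U + b * χ (ev S θ (halfOf τ₂)) U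

/-- The test observable is measurable. -/
theorem measurable_obs (a b : ℂ) (τ₁ τ₂ : ZMod (2 * S + 1) → Pattern S) :
    Measurable (obs θ a b τ₁ τ₂) :=
  (measurable_const.mul (measurable_χ (measurableSet_ev _))).add
    (measurable_const.mul (measurable_χ (measurableSet_ev _)))

/-- The test observable is bounded by `‖a‖ + ‖b‖`. -/
theorem norm_obs_le (a b : ℂ) (τ₁ τ₂ : ZMod (2 * S + 1) → Pattern S) (U : GaugeConfig 4 (2 * S + 1) SU3) :
    ‖obs θ a b τ₁ τ₂ U‖ ≤ ‖a‖ + ‖b‖ := by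
  unfold obs
  refine (norm_add_le _ _).trans (add_le_add ?_ ?_)
  · rw [norm_mul]
    exact (mul_le_mul_of_nonneg_left (norm_χ_le _ _) (norm_nonneg _)).trans (mul_one _).le
  · rw [norm_mul]
    exact (mul_le_mul_of_nonneg_left (norm_χ_le _ _) (norm_nonneg _)).trans (mul_one _).le

/-- The half events live on the spatial links of the slices `1 ≤ t ≤ S + 1` (`P ∪ M`). -/
theorem mem_ev_halfOf_congr {U V : GaugeConfig 4 (2 * S + 1) SU3}
    (hUV : ∀ e ∈ ((WilsonOddRP.oPosEdges ∪ WilsonOddRP.oSharedEdges :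
      Finset (Edge 4 (2 * S + 1))) : Set (Edge 4 (2 * S + 1))), U e = V e)
    (τ : ZMod (2 * S + 1) → Pattern S) : U ∈ ev S θ (halfOf τ) ↔ V ∈ ev S θ (halfOf τ) := by
  unfold ev halfOf
  simp only [Set.mem_setOf_eq]
  refine forall_congr' fun t => ?_
  by_cases hp : t ∈ cPlus S
  · simp only [if_pos hp]
    refine forall_congr' fun xs => forall_congr' fun _ => cubeFlat_congr fun s i => hUV _ ?_
    have h0 : (corner (siteOf t xs) s 0).val = t.val := by
      rw [corner_apply_zero, siteOf_apply_zero]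
    rw [Finset.mem_coe, Finset.mem_union, WilsonOddRP.mem_oPosEdges, WilsonOddRP.mem_oSharedEdges]
    rw [mem_cPlus] at hp
    by_cases ht : t.val ≤ S
    · left
      refine ⟨?_, ?_⟩
      · show 1 ≤ (corner (siteOf t xs) s 0).val
        omega
      · show (corner (siteOf t xs) s 0).val ≤ (2 * S + 1) / 2
        omega
    · right
      refine ⟨Fin.succ_ne_zero i, ?_⟩
      show (corner (siteOf t xs) s 0).val = (2 * S + 1) / 2 + 1
      omega
  · simp only [if_neg hp, Finset.notMem_empty, false_imp_iff, imp_true_iff]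

/-- The test observable depends only on the links of `P ∪ M` (slices `1 ≤ t ≤ S + 1`, spatial). -/
theorem dependsOn_obs (a b : ℂ) (τ₁ τ₂ : ZMod (2 * S + 1) → Pattern S) :
    DependsOn (obs θ a b τ₁ τ₂) ((WilsonOddRP.oPosEdges ∪ WilsonOddRP.oSharedEdges :
      Finset (Edge 4 (2 * S + 1))) : Set (Edge 4 (2 * S + 1))) := by
  intro U V hUV
  have h1 := χ_congr (mem_ev_halfOf_congr (θ := θ) hUV τ₁)
  have h2 := χ_congr (mem_ev_halfOf_congr (θ := θ) hUV τ₂)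
  simp only [obs, h1, h2]

/-- The RP integrand of the test observable, integrated. -/
theorem integral_obs (hS : 1 ≤ S) (a b : ℂ) (τ₁ τ₂ : ZMod (2 * S + 1) → Pattern S) :
    ∫ U, conj (obs θ a b τ₁ τ₂ U.timeReflect) * obs θ a b τ₁ τ₂ U ∂(μW S β) =
      conj a * a * ((((μW S β).real (ev S θ (glue τ₁ τ₁)) : ℝ)) : ℂ)
      + conj b * a * ((((μW S β).real (ev S θ (glue τ₁ τ₂)) : ℝ)) : ℂ)
      + conj a * b * ((((μW S β).real (ev S θ (glue τ₂ τ₁)) : ℝ)) : ℂ)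
      + conj b * b * ((((μW S β).real (ev S θ (glue τ₂ τ₂)) : ℝ)) : ℂ) := by
  have hpt : ∀ U, conj (obs θ a b τ₁ τ₂ U.timeReflect) * obs θ a b τ₁ τ₂ U =
      conj a * a * χ (ev S θ (glue τ₁ τ₁)) U + conj b * a * χ (ev S θ (glue τ₁ τ₂)) U
      + conj a * b * χ (ev S θ (glue τ₂ τ₁)) U + conj b * b * χ (ev S θ (glue τ₂ τ₂)) U := by
    intro U
    simp only [obs, ← ev_halfOf_inter hS, χ_apply, Set.mem_inter_iff, Set.mem_preimage]
    by_cases h1 : U ∈ ev S θ (halfOf τ₁) <;> by_cases h2 : U ∈ ev S θ (halfOf τ₂) <;>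
      by_cases h3 : U.timeReflect ∈ ev S θ (halfOf τ₁) <;>
      by_cases h4 : U.timeReflect ∈ ev S θ (halfOf τ₂) <;> simp [h1, h2, h3, h4] <;> ring
  have hI : ∀ (k : ℂ) (σ' : ZMod (2 * S + 1) → Pattern S),
      Integrable (fun U => k * χ (ev S θ σ') U) (μW S β) :=
    fun k σ' => (integrable_χ (measurableSet_ev σ')).const_mul k
  simp_rw [hpt]
  rw [integral_add4 (hI _ _) (hI _ _) (hI _ _) (hI _ _),
    integral_const_mul, integral_const_mul, integral_const_mul, integral_const_mul,
    integral_χ (measurableSet_ev _), integral_χ (measurableSet_ev _), integral_χ (measurableSet_ev _),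
    integral_χ (measurableSet_ev _)]

/-- **Reflection Schwarz inequality** for joint flat events (odd-torus Osterwalder–Seiler
positivity tested on `F + iG` and on `xF - G`). -/
theorem schwarz (hS : 1 ≤ S) (hβ : 0 ≤ β) (σ : ZMod (2 * S + 1) → Pattern S) :
    ((μW S β).real (ev S θ σ)) ^ 2 ≤
      (μW S β).real (ev S θ (plusHalf σ)) * (μW S β).real (ev S θ (minusHalf σ)) := by
  set p := (μW S β).real (ev S θ (plusHalf σ)) with hp
  set m := (μW S β).real (ev S θ (minusHalf σ)) with hm
  set c := (μW S β).real (ev S θ σ) with hc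
  set c' := (μW S β).real (ev S θ (glue (minusHalf σ) σ)) with hc'
  have hRP : ∀ a b : ℂ, 0 ≤ conj a * a * (p : ℂ) + conj b * a * (c : ℂ) + conj a * b * (c' : ℂ)
      + conj b * b * (m : ℂ) := by
    intro a b
    have h := wilsonExpectation_oddReflectionPositive (d := 4) (L := 2 * S + 1)
      (fundamentalRep (Fin 3)) (odd_two_mul_add_one S) (by omega) (continuous_fundamentalRep (Fin 3))
      hβ (obs θ a b σ (minusHalf σ)) (measurable_obs a b _ _) ⟨‖a‖ + ‖b‖, norm_obs_le a b _ _⟩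
      (dependsOn_obs a b _ _)
    rw [wilsonExpectation, integral_obs hS, glue_self_self, glue_self_minusHalf hS,
      glue_minusHalf_minusHalf hS] at h
    exact h
  have hsymm : c' = c := by
    have h := (Complex.le_def.1 (hRP 1 Complex.I)).2
    simp at h
    linarith
  have hquad : ∀ x : ℝ, 0 ≤ p * (x * x) + (-(2 * c)) * x + m := by
    intro x
    have h := (Complex.le_def.1 (hRP x (-1))).1
    simp at h
    rw [hsymm] at h
    linarith
  have hd := discrim_le_zero hquad
  rw [discrim] at hd
  nlinarith [hd]

/-- **Rotation invariance** of the joint flat events (time-translation invariance of the Wilson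
measure). -/
theorem measure_ev_rot (σ : ZMod (2 * S + 1) → Pattern S) (a : ZMod (2 * S + 1)) :
    μW S β (ev S θ (fun t => σ (t + a))) = μW S β (ev S θ σ) := by
  have hpre : (torusConfigShift (siteOf a (0 : Fin 3 → ZMod (2 * S + 1)))) ⁻¹' (ev S θ σ) =
      ev S θ (fun t => σ (t + a)) := by
    ext U
    simp only [Set.mem_preimage, ev, Set.mem_setOf_eq, cubeFlat_torusConfigShift, siteOf_sub_siteOf]
    constructor
    · intro h t xs hxs
      have := h (t + a) xs hxs
      rwa [add_sub_cancel_right] at this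
    · intro h t xs hxs
      exact h (t - a) xs (by rwa [sub_add_cancel])
  rw [← hpre, ← Measure.map_apply (torusConfigShift _).measurable (measurableSet_ev σ),
    wilsonMeasure_map_torusConfigShift]

/-- **The chessboard estimate for joint flat events on the odd torus.** -/
theorem measureReal_ev_pow_le (hS : 1 ≤ S) (hβ : 0 ≤ β) (σ : ZMod (2 * S + 1) → Pattern S) :
    ((μW S β).real (ev S θ σ)) ^ (2 * S + 1) ≤ ∏ t, (μW S β).real (ev S θ (fun _ => σ t)) :=
  OddCycle.chessboard hS (fun τ => (μW S β).real (ev S θ τ)) (fun _ => measureReal_nonneg)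
    (fun τ a => by simp only [measureReal_def, measure_ev_rot]) (schwarz hS hβ) σ

end Events

/-! ## §E  The stub -/

/-- **(S1) Time-column chessboard on ODD tori, Peierls form** (Fröhlich–Israel–Lieb–Simon 1978
Thm 2.2 in the time direction; input: odd-torus Osterwalder–Seiler positivity
`wilsonExpectation_oddReflectionPositive` and time-translation invariance of the Wilson measure).
On the torus `(ℤ/(2S+1)ℤ)⁴`, `S ≥ 1`, `β ≥ 0`: if every time-invariant pattern `X × ℤ_{2S+1}` of
`θ`-flat cubes has probability `≤ q^{(2S+1)|X|}`, then every finite set `A` of `θ`-flat cubes has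
probability `≤ q^{|A|}`. -/
theorem stub_chessboard : ∀ (S : ℕ), 1 ≤ S → ∀ (β θ q : ℝ), 0 ≤ β → 0 ≤ q →
    (∀ X : Finset (Fin 3 → ZMod (2 * S + 1)),
      (wilsonMeasure (fundamentalRep (Fin 3)) β : Measure (GaugeConfig 4 (2 * S + 1) SU3))
          {U | ∀ xs ∈ X, ∀ t : ZMod (2 * S + 1), CubeFlat U (siteOf t xs) θ}
        ≤ ENNReal.ofReal (q ^ ((2 * S + 1) * X.card))) →
    ∀ A : Finset (TorusSite 4 (2 * S + 1)),
      (wilsonMeasure (fundamentalRep (Fin 3)) β : Measure (GaugeConfig 4 (2 * S + 1) SU3))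
          {U | ∀ y ∈ A, CubeFlat U y θ}
        ≤ ENNReal.ofReal (q ^ A.card) := by
  intro S hS β θ q hβ hq hX A
  classical
  haveI := isProbabilityMeasure_wilsonMeasure (d := 4) (L := 2 * S + 1) (fundamentalRep (Fin 3))
    (continuous_fundamentalRep (Fin 3)) β
  -- the slices of `A`
  set X : ZMod (2 * S + 1) → Pattern S := fun t => Finset.univ.filter fun xs => siteOf t xs ∈ A
    with hXdef
  have hmemX : ∀ t xs, xs ∈ X t ↔ siteOf t xs ∈ A := fun t xs => by simp [hXdef]
  have hA : {U : GaugeConfig 4 (2 * S + 1) SU3 | ∀ y ∈ A, CubeFlat U y θ} = ev S θ X := by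
    ext U
    simp only [Set.mem_setOf_eq, ev, hmemX]
    constructor
    · exact fun h t xs hxs => h _ hxs
    · intro h y hy
      have := h (y 0) (Fin.tail y) (by rwa [siteOf_self_tail])
      rwa [siteOf_self_tail] at this
  -- cardinalities: `|A| = Σ_t |X t|`
  have hcard : A.card = ∑ t, (X t).card := by
    rw [Finset.card_eq_sum_card_fiberwise (f := fun y : TorusSite 4 (2 * S + 1) => y 0)
      (t := Finset.univ) (fun _ _ => Finset.mem_coe.2 (Finset.mem_univ _))]
    refine Finset.sum_congr rfl fun t _ => ?_
    rw [← Finset.card_image_of_injective (X t) (siteOf_injective t)]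
    congr 1
    ext y
    simp only [Finset.mem_filter, Finset.mem_image, hmemX]
    constructor
    · rintro ⟨hy, rfl⟩
      exact ⟨Fin.tail y, by rwa [siteOf_self_tail], siteOf_self_tail y⟩
    · rintro ⟨xs, hxs, rfl⟩
      exact ⟨hxs, siteOf_apply_zero t xs⟩
  -- the hypothesis in `ev` form
  have hcol : ∀ t, (μW S β).real (ev S θ (fun _ => X t)) ≤ q ^ ((2 * S + 1) * (X t).card) := by
    intro t
    have hset : ev S θ (fun _ => X t) =
        {U | ∀ xs ∈ X t, ∀ t' : ZMod (2 * S + 1), CubeFlat U (siteOf t' xs) θ} := by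
      ext U
      simp only [ev, Set.mem_setOf_eq]
      exact ⟨fun h xs hxs t' => h t' xs hxs, fun h t' xs hxs => h xs hxs t'⟩
    rw [measureReal_def, hset]
    exact ENNReal.toReal_le_of_le_ofReal (pow_nonneg hq _) (hX (X t))
  -- chessboard
  have hchess := measureReal_ev_pow_le (θ := θ) hS hβ X
  have hprod : ∏ t, (μW S β).real (ev S θ (fun _ => X t)) ≤ (q ^ A.card) ^ (2 * S + 1) := by
    calc ∏ t, (μW S β).real (ev S θ (fun _ => X t))
        ≤ ∏ t : ZMod (2 * S + 1), q ^ ((2 * S + 1) * (X t).card) :=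
          Finset.prod_le_prod (fun t _ => measureReal_nonneg) fun t _ => hcol t
      _ = (q ^ A.card) ^ (2 * S + 1) := by
          rw [Finset.prod_pow_eq_pow_sum, ← Finset.mul_sum, ← hcard, pow_mul, pow_right_comm]
  have hreal : (μW S β).real (ev S θ X) ≤ q ^ A.card :=
    (pow_le_pow_iff_left₀ measureReal_nonneg (pow_nonneg hq _) (by omega : 2 * S + 1 ≠ 0)).1
      (hchess.trans hprod)
  rw [hA]
  exact (ENNReal.le_ofReal_iff_toReal_le (measure_ne_top _ _) (pow_nonneg hq _)).2 hreal

/-- `stub_chessboard` in the skeleton's verbatim surface syntax (named arguments `(d := 4) (L := 2S+1)`;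
the registered form above uses the equivalent type ascription because the stub registry cannot hold
`:=`): this is literally the body of the line's `ColumnChessboard`. -/
theorem columnChessboard_of_stub_chessboard : ∀ (S : ℕ), 1 ≤ S → ∀ (β θ q : ℝ), 0 ≤ β → 0 ≤ q →
    (∀ X : Finset (Fin 3 → ZMod (2 * S + 1)),
      (wilsonMeasure (d := 4) (L := 2 * S + 1) (fundamentalRep (Fin 3)) β)
          {U | ∀ xs ∈ X, ∀ t : ZMod (2 * S + 1), CubeFlat U (siteOf t xs) θ}
        ≤ ENNReal.ofReal (q ^ ((2 * S + 1) * X.card))) →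
    ∀ A : Finset (TorusSite 4 (2 * S + 1)),
      (wilsonMeasure (d := 4) (L := 2 * S + 1) (fundamentalRep (Fin 3)) β)
          {U | ∀ y ∈ A, CubeFlat U y θ}
        ≤ ENNReal.ofReal (q ^ A.card) :=
  stub_chessboard

end Summit.QuantumFields.QCD.Cruxes.WindowExtinction.ChessboardColdCells

end
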